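import Literature.NumberTheory.EllipticCurves.HuShuYin2019.SylvesterTowerFrobeniusAtThree
import Literature.NumberTheory.EllipticCurves.HuShuYin2019.SylvesterTowerRamifiedLayerDegree
import Literature.NumberTheory.EllipticCurves.LocalRestrictionUnramifiedDescentProofs
import HarnessLib

/-!
# The LOCAL clause of the tower fixing at `w ∣ 3`: an involution `φ ∈ Gal(K[9pn]/K)` lying in the image of the
# local Galois group `Γ_{K_w}` has ODD index in that image — so `Φ := res⁻¹⟨φ⟩ ≤ Γ_{K_w}` is open, of index
# prime to `2`, and acts on `e(K[9pn]) ⊂ K̄` through `{1, φ}` (memo two §67.2 (W2-a)/(W2-d), THEOREM (γ))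

Topic `NumberTheory/EllipticCurves/HuShuYin2019` (vocabulary: `HeegnerPointsOfConductor.lean` — the concrete ring class
field `K[n] = ringClassField K ι n ⊂ ℂ`; `RingClassFieldTower.lean` — `K[m] ≤ K[n]` (`ringClassField_mono`), the
`K`-algebra inclusion `RingClassField.inclusion`, `subfieldIn ι n m = K[n] ∩ K[m]`; `Sha.lean` — the restriction
`resGal (K := K) E : Γ_E →ₜ* Γ_K` for a `K`-field `E`, here the completion `E = K_v = v.adicCompletion K`;
`SelmerInertia.lean` / `LocalRestrictionUnramifiedDescentProofs.lean` §3 — `v.localPrimesAbove`, the prime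
`𝔓 = v.primeBelow ι 𝔐` of `ar ℤ_K` and **`resGalOfEmb_mem_decompositionSubgroup_primeBelow`: `Γ_{K_v}` restricts INTO
the decomposition group `D_𝔓 ≤ Γ_K`** (Neukirch II (9.6), the inclusion); Mathlib `Ideal.card_stabilizer_eq`:
`#Stab_{Gal(M/K)}(P) = e(P|v) f(P|v)`).  Sequel of `SylvesterTowerFrobeniusAtThree.lean` (`e_w = 1`, `f_w = 2` for
`K[m]/K`, `3 ∤ m`) and `SylvesterTowerRamifiedLayerDegree.lean` (`[K[9m] : K[m]] = 9`).  THEOREMS ONLY (no definition,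
no named fact, no instance, no `sorry`; D-0026, net debt 0).  Seat `bsd-cm-k-ty1` g9, planner WANT (W2-d)-(γ) (D533 (2),
GO D534 (3)): §2 is the `∃ Φ` clause of the tower-fixing hypothesis `hTF` of
`Summits/…/Theorems/SylvesterTwoHeegnerIndexCMHalfLayerL1.lean` (p685405, l.80–85) VERBATIM, derived from «`φ` lies in the
decomposition group at `v` w.r.t. `e`»; consumed by the rows' wrapper #S10 (planner D535 (T3)).  It DISCHARGES that local
clause modulo decomposition membership; it does not touch the GLOBAL clause (`φ_n` fixes `y_n`, restricts to `s`), which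
stays displayed.  No summit statement is proved or advanced by this file alone.

## THE PRINT

Neukirch [NeukirchANT1999] Ch. II §9 Prop. (9.6) (Springer ed. PDF p. 159): for a Galois `L|K` and the completions at `w ∣ v`,
«`G(L_w|K_v) ≅ G_w(L|K)`» (the decomposition group), compatible with inertia and Frobenius; Ch. I §9 Prop. (9.3)–(9.6):
`#G_w = e_w f_w`.  Serre [SerreGaloisCohomology1997] II.§1.1 / Silverman AEC X.§4: `G_v ⊂ G_K` via an embedding
`K̄ ⊂ K̄_v`.  Cox [Cox2013] §9.A (PDF pp. 192–193): `Gal(K[f]/K) ≃ I_K(f)/P_{K,ℤ}(f)`.  Hu–Shu–Yin [HuShuYin2019] §2.2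
Prop. 2.4 (PDF pp. 6–7): the tower `H_{9p} ⊇ H_{3p} ⊇ H_p ⊇ K`.  The argument itself (planner D533 (2), simplified): let
`ρ : Γ_{K_v} → Gal(K[N]/K)`, `τ ↦` the automorphism through which `res τ` acts on `e(K[N])`, `D := im ρ ∋ φ`.  Restricting
to `K[M]` (`M ∣ N`) sends `D` into the decomposition group of the prime `P = e⁻¹(𝔓) ∩ 𝓞_{K[M]}`, of order `e f`; the kernel
of `Gal(K[N]/K) → Gal(K[M]/K)` has order `[K[N] : K[M]]`.  Hence `#D = a·b` with `a ∣ [K[N] : K[M]]` and `b ∣ e f`; if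
`[K[N] : K[M]]` is ODD and `e f = 2`, then, as `2 = ord φ ∣ #D`, `#D = 2a` with `a` odd, and `Φ := ρ⁻¹⟨φ⟩` has index
`[D : ⟨φ⟩] = a`.  At `K = ℚ(ω)`, `N = 9pn`, `M = pn` (`p ≡ 1 (3)`, `3 ∤ n`): `[K[N] : K[M]] = 9`
(`JZero.finrank_subfieldIn_nine_mul`) and `e_v f_v(K[M]/K) = 1 · 2` (`JZero.ramificationIdxIn_ringClassField_three`,
`JZero.inertiaDegIn_ringClassField_three`) — no total-ramification or `(ℤ/3)²`-structure input is needed.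

## WHAT IS FORMALISED (`K : Type` imaginary quadratic, `ι : K → ℂ`, `v` a finite place, `e : K[N] →+* K̄` over `K`,
## `φ : K[N] ≃ₐ[K] K[N]` with `φ ≠ 1`, `φ² = 1`, `hφD : ∃ τ₀ ∈ Γ_{K_v}, res τ₀ ∘ e = e ∘ φ`)

* §1 `RingClassTower.exists_oddIndex_subgroup_of_exists_resGal_eq` — GENERAL levels `M ∣ N`, `N ≥ 1`, hypotheses
  `Odd [K[N] : K[M]]` (as `finrank (subfieldIn ι N M) K[N]`) and `e_v · f_v (K[M]/K) = 2` (as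
  `ramificationIdxIn · inertiaDegIn`): **`∃ Φ ≤ Γ_{K_v}` open, `IsCoprime Φ.index 2`, every `τ ∈ Φ` acts on `e(K[N])` as
  `1` or as `φ`**.
* §2 `JZero.exists_oddIndex_subgroup_sylvesterTower` — **THEOREM (γ)**: `K ⊨ ω² + ω + 1 = 0`, `[K : ℚ] = 2`, `p` prime,
  `p % 3 = 1`, `n ≠ 0`, `3 ∤ n`, level `9 * p * n`, `v ∋ 3`: the same conclusion, i.e. the `∃ Φ` clause of #S9c's `hTF`
  verbatim (checked whitespace-normalised against the tree file).

NOT HERE (by design / not in the tree): the SURJECTION `Γ_{K_v} ↠ D_𝔓` (Neukirch II (9.6) «≅»; the tree has «⊂»), hence no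
claim that the image of `Γ_{K_v}` has order exactly `18`; the EXISTENCE/uniqueness of a decomposition involution fixing
`∛3`, `∛p` ((γ′), provisional no-offer D534 (3)) — although a local Frobenius lift (`exists_isArithFrobAt_localAbsIntegers`
+ `isArithFrobAt_resGalOfEmb` + `SylvesterTowerFrobeniusAtThree`) would give SOME involution in the local image acting on
`K[pn]` as the Frobenius involution; anything about elliptic curves.

## References

* J. Neukirch, *Algebraic Number Theory*, Springer 1999, Ch. I §9 (9.3)–(9.6), Ch. II §9 Prop. (9.6). [NeukirchANT1999]
* J.-P. Serre, *Galois Cohomology*, Springer 1997, II.§1.1. [SerreGaloisCohomology1997]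
* D. A. Cox, *Primes of the form x² + ny²*, 2nd ed., Wiley 2013, §9.A (9.1). [Cox2013]
* Y. Hu, J. Shu, H. Yin, *An explicit Gross–Zagier formula related to the Sylvester conjecture*, Trans. AMS 372 (2019),
  §2.2 Prop. 2.4. [HuShuYin2019]

## Mathlib / tree search

Tree: `resGalOfEmb_mem_decompositionSubgroup_primeBelow`, `localPrimesAbove_nonempty`, `primeBelow_mem_primesAbove`,
`resGal` (= `resGalOfEmb (closureEmb _)`, rfl), `absoluteGaloisGroup.toAlgEquiv`, `finiteDimensional_and_isGalois_ringClassField`,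
`ringClassField_mono`, `RingClassField.inclusion`, `finrank_subfieldIn_mul_finrank`, `JZero.finrank_subfieldIn_nine_mul`,
`JZero.ramificationIdxIn_ringClassField_three`, `JZero.inertiaDegIn_ringClassField_three` (pattern of
`LocalRestrictionUnramifiedDescentProofs.smul_eq_of_mem_stabilizer_of_ncard_primesOver_eq`).  Mathlib: `AlgEquiv.restrictNormalHom`,
`AlgEquiv.restrictNormal_commutes`, `AlgEquiv.restrictNormalHom_surjective`, `Ideal.card_stabilizer_eq`,
`Ideal.mem_decompositionSubgroup_iff`, `IsGaloisGroup.of_isFractionRing`, `IntermediateField.fixingSubgroup_isOpen`,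
`Subgroup.isOpen_mono`, `Subgroup.index_comap`, `Subgroup.index_ker`, `Subgroup.card_mul_index`, `Nat.card_zpowers`.
-/

noncomputable section

open scoped Classical NumberField Pointwise
open NumberField IsDedekindDomain IsDedekindDomain.HeightOneSpectrum Module Field

namespace Literature.NumberTheory.EllipticCurves.HuShuYin2019

open Literature.NumberTheory.EllipticCurves Literature.NumberTheory.GaloisRepresentations
open Literature.NumberTheory.EllipticCurves.RingClassField

variable {K : Type} [Field K] [NumberField K] {ω : K}

/-! ## §1 The general mechanism: an involution in the local image has odd index in it -/

/-- **An involution in the local image has odd index in it.**  `K` imaginary quadratic, levels `M ∣ N` (`N ≥ 1`) with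
`[K[N] : K[M]]` ODD, a finite place `v` with `e_v f_v (K[M]/K) = 2`, a `K`-embedding `e : K[N] → K̄`, and an involution
`φ ≠ 1` of `K[N]/K` through which some `τ₀ ∈ Γ_{K_v}` acts on `e(K[N])` (via `resGal`).  Then there is an OPEN subgroup
`Φ ≤ Γ_{K_v}` of index prime to `2` (namely `res⁻¹⟨φ⟩`, of index `#im/2` odd) every element of which acts on `e(K[N])`
as `1` or as `φ`. [cite: NeukirchANT1999, Ch. II §9 Prop. (9.6) (PDF p. 159: «G_w(L|K) ≅ G(L_w|K_v)») and Ch. I §9 (9.3)–(9.6) (#G_w = e f)]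
[cite: SerreGaloisCohomology1997, II.§1.1 (G_v ⊂ G_K)] [cite: Cox2013, §9.A (9.1) (PDF pp. 192–193)] -/
theorem RingClassTower.exists_oddIndex_subgroup_of_exists_resGal_eq
    (hK : IsImaginaryQuadratic K) (ι : K →+* ℂ) {M N : ℕ} (hMN : M ∣ N) (hN : N ≠ 0)
    (hodd : Odd (finrank (subfieldIn ι N M) (ringClassField K ι N)))
    (v : HeightOneSpectrum (𝓞 K))
    (hef : v.asIdeal.ramificationIdxIn (𝓞 (ringClassField K ι M)) *
      v.asIdeal.inertiaDegIn (𝓞 (ringClassField K ι M)) = 2)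
    (e : ringClassField K ι N →+* AlgebraicClosure K)
    (he : ∀ k : K, e (algebraMap K (ringClassField K ι N) k) = algebraMap K (AlgebraicClosure K) k)
    {φ : ringClassField K ι N ≃ₐ[K] ringClassField K ι N} (hφ1 : φ ≠ 1) (hφ2 : φ * φ = 1)
    (hφD : ∃ τ₀ : absoluteGaloisGroup (v.adicCompletion K), ∀ x : ringClassField K ι N,
      (show AlgebraicClosure K ≃ₐ[K] AlgebraicClosure K from
        resGal (K := K) (v.adicCompletion K) τ₀) (e x) = e (φ x)) :
    ∃ Φ : Subgroup (absoluteGaloisGroup (v.adicCompletion K)),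
      IsOpen (Φ : Set (absoluteGaloisGroup (v.adicCompletion K))) ∧ IsCoprime (Φ.index : ℤ) ((2 : ℕ) : ℤ) ∧
      ∀ τ ∈ Φ, (∀ x : ringClassField K ι N, (show AlgebraicClosure K ≃ₐ[K] AlgebraicClosure K from
          resGal (K := K) (v.adicCompletion K) τ) (e x) = e x) ∨
        (∀ x : ringClassField K ι N, (show AlgebraicClosure K ≃ₐ[K] AlgebraicClosure K from
          resGal (K := K) (v.adicCompletion K) τ) (e x) = e (φ x)) := by
  have hM : M ≠ 0 := ne_zero_of_dvd_ne_zero hN hMN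
  haveI := (finiteDimensional_and_isGalois_ringClassField hK ι hN).1
  haveI := (finiteDimensional_and_isGalois_ringClassField hK ι hN).2
  haveI := (finiteDimensional_and_isGalois_ringClassField hK ι hM).1
  haveI := (finiteDimensional_and_isGalois_ringClassField hK ι hM).2
  haveI : NumberField (ringClassField K ι M) := NumberField.of_module_finite K _
  -- the tower `K ⊆ K[M] ⊆ K[N]`
  have hle : ringClassField K ι M ≤ ringClassField K ι N := ringClassField_mono hK ι hMN hN
  letI : Algebra (ringClassField K ι M) (ringClassField K ι N) :=
    (RingClassField.inclusion ι hle).toRingHom.toAlgebra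
  haveI : IsScalarTower K (ringClassField K ι M) (ringClassField K ι N) :=
    IsScalarTower.of_algebraMap_eq fun k => ((RingClassField.inclusion ι hle).commutes k).symm
  -- `K[N] ⊆ K̄` through `e`
  let e' : ringClassField K ι N →ₐ[K] AlgebraicClosure K := AlgHom.mk e he
  have he' : ∀ x, e' x = e x := fun _ => rfl
  letI : Algebra (ringClassField K ι N) (AlgebraicClosure K) := e.toAlgebra
  haveI : IsScalarTower K (ringClassField K ι N) (AlgebraicClosure K) :=
    IsScalarTower.of_algebraMap_eq fun k => (he k).symm
  -- the restriction `r : Γ_K → Gal(K[N]/K)` and `ρ = r ∘ res : Γ_{K_v} → Gal(K[N]/K)`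
  let r : absoluteGaloisGroup K →* (ringClassField K ι N ≃ₐ[K] ringClassField K ι N) :=
    (AlgEquiv.restrictNormalHom (ringClassField K ι N)).comp (absoluteGaloisGroup.toAlgEquiv K).toMonoidHom
  have hr : ∀ (σ : absoluteGaloisGroup K) (y : ringClassField K ι N), e (r σ y) = σ • e y := fun σ y =>
    AlgEquiv.restrictNormal_commutes (absoluteGaloisGroup.toAlgEquiv K σ) (ringClassField K ι N) y
  let ρ : absoluteGaloisGroup (v.adicCompletion K) →* (ringClassField K ι N ≃ₐ[K] ringClassField K ι N) :=
    r.comp (resGal (K := K) (v.adicCompletion K)).toMonoidHom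
  have hρ : ∀ τ y, e (ρ τ y) = (show AlgebraicClosure K ≃ₐ[K] AlgebraicClosure K from
      resGal (K := K) (v.adicCompletion K) τ) (e y) := fun τ y => by
    change e (r (resGal (K := K) (v.adicCompletion K) τ) y) = _
    rw [hr]
    rfl
  -- `φ = ρ τ₀`
  obtain ⟨τ₀, hτ₀⟩ := hφD
  have hρτ₀ : ρ τ₀ = φ := by
    apply AlgEquiv.ext
    intro y
    apply e.injective
    rw [hρ, hτ₀]
  have hφ2' : φ ^ 2 = 1 := by rw [pow_two]; exact hφ2
  haveI : Fact (Nat.Prime 2) := ⟨Nat.prime_two⟩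
  have hordφ : orderOf φ = 2 := orderOf_eq_prime hφ2' hφ1
  -- the candidate: `Φ = ρ⁻¹ ⟨φ⟩`
  set D := ρ.range with hDdef
  have hφmem : φ ∈ D := ⟨τ₀, hρτ₀⟩
  have hzle : Subgroup.zpowers φ ≤ D := Subgroup.zpowers_le.mpr hφmem
  refine ⟨(Subgroup.zpowers φ).comap ρ, ?_, ?_, ?_⟩
  · -- OPEN: contains `res⁻¹ Gal(K̄ / e K[N])`
    haveI : FiniteDimensional K e'.fieldRange :=
      LinearEquiv.finiteDimensional (AlgEquiv.ofInjectiveField e').toLinearEquiv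
    have hc : Continuous (absoluteGaloisGroup.toAlgEquiv K) := continuous_id
    have hopen : IsOpen (((e'.fieldRange.fixingSubgroup.comap
        (absoluteGaloisGroup.toAlgEquiv K).toMonoidHom).comap
        (resGal (K := K) (v.adicCompletion K)).toMonoidHom : Subgroup _) :
          Set (absoluteGaloisGroup (v.adicCompletion K))) :=
      ((IntermediateField.fixingSubgroup_isOpen e'.fieldRange).preimage hc).preimage
        (resGal (K := K) (v.adicCompletion K)).continuous
    refine Subgroup.isOpen_mono ?_ hopen
    intro τ hτ
    rw [Subgroup.mem_comap, Subgroup.mem_comap, IntermediateField.mem_fixingSubgroup_iff] at hτ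
    rw [Subgroup.mem_comap]
    have h1 : ρ τ = 1 := by
      apply AlgEquiv.ext
      intro y
      apply e.injective
      rw [hρ, AlgEquiv.one_apply]
      exact hτ (e y) ⟨y, he' y⟩
    rw [h1]
    exact one_mem _
  · -- ODD INDEX
    -- `2 · [Γ_{K_v} : Φ] = #D`
    have hindex : ((Subgroup.zpowers φ).comap ρ).index = ((Subgroup.zpowers φ).subgroupOf D).index :=
      Subgroup.index_comap _ _
    have hcard2 : Nat.card ((Subgroup.zpowers φ).subgroupOf D) = 2 := by
      rw [Nat.card_congr (Subgroup.subgroupOfEquivOfLe hzle).toEquiv, Nat.card_zpowers, hordφ]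
    have hD2 : 2 * ((Subgroup.zpowers φ).comap ρ).index = Nat.card D := by
      rw [← hcard2, hindex]
      exact Subgroup.card_mul_index _
    -- the restriction `π : Gal(K[N]/K) → Gal(K[M]/K)`; `#ker π = [K[N] : K[M]]`
    set π : (ringClassField K ι N ≃ₐ[K] ringClassField K ι N) →*
        (ringClassField K ι M ≃ₐ[K] ringClassField K ι M) :=
      AlgEquiv.restrictNormalHom (ringClassField K ι M) with hπdef
    have hπapp : ∀ σ y, RingClassField.inclusion ι hle (π σ y) = σ (RingClassField.inclusion ι hle y) :=
      fun σ y => AlgEquiv.restrictNormal_commutes σ (ringClassField K ι M) y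
    have hπsurj : Function.Surjective π :=
      AlgEquiv.restrictNormalHom_surjective (F := K) (K₁ := ringClassField K ι M) (ringClassField K ι N)
    have hker : Nat.card π.ker = finrank (subfieldIn ι N M) (ringClassField K ι N) := by
      have h1 : Nat.card π.ker * π.ker.index =
          Nat.card (ringClassField K ι N ≃ₐ[K] ringClassField K ι N) := Subgroup.card_mul_index _
      rw [Subgroup.index_ker, MonoidHom.range_eq_top.mpr hπsurj, Subgroup.card_top,
        IsGalois.card_aut_eq_finrank, IsGalois.card_aut_eq_finrank,
        ← finrank_subfieldIn_mul_finrank hK ι hMN hN] at h1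
      exact Nat.eq_of_mul_eq_mul_right Module.finrank_pos h1
    -- `𝓞 K[M] → \bar ℤ_K` along `e ∘ (K[M] ↪ K[N])`, and the prime `P` of `K[M]` below `𝔓`
    haveI : Module.Finite (𝓞 K) (𝓞 (ringClassField K ι M)) :=
      IsIntegralClosure.finite (𝓞 K) K (ringClassField K ι M) (𝓞 (ringClassField K ι M))
    haveI : IsGaloisGroup (ringClassField K ι M ≃ₐ[K] ringClassField K ι M) (𝓞 K) (𝓞 (ringClassField K ι M)) :=
      IsGaloisGroup.of_isFractionRing (ringClassField K ι M ≃ₐ[K] ringClassField K ι M) (𝓞 K) (𝓞 (ringClassField K ι M)) K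
        (ringClassField K ι M)
    let eM : ringClassField K ι M →ₐ[K] AlgebraicClosure K := e'.comp (RingClassField.inclusion ι hle)
    have heM : ∀ y, eM y = e (RingClassField.inclusion ι hle y) := fun _ => rfl
    let ιM : 𝓞 (ringClassField K ι M) →+* absIntegers (𝓞 K) K :=
      (eM.toRingHom.comp (algebraMap (𝓞 (ringClassField K ι M)) (ringClassField K ι M))).codRestrict
        (absIntegers (𝓞 K) K) fun x ↦ by
        change eM (algebraMap (𝓞 (ringClassField K ι M)) (ringClassField K ι M) x) ∈
          integralClosure (𝓞 K) (AlgebraicClosure K)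
        rw [mem_integralClosure_iff]
        have hx : IsIntegral ℤ (eM (algebraMap (𝓞 (ringClassField K ι M)) (ringClassField K ι M) x)) :=
          (RingOfIntegers.isIntegral_coe x).map (eM.restrictScalars ℤ)
        exact hx.tower_top
    have hιcoe : ∀ x : 𝓞 (ringClassField K ι M), (ιM x : AlgebraicClosure K) = eM (x : ringClassField K ι M) :=
      fun _ ↦ rfl
    have hιcomp : ιM.comp (algebraMap (𝓞 K) (𝓞 (ringClassField K ι M))) =
        algebraMap (𝓞 K) (absIntegers (𝓞 K) K) := by
      ext k
      change eM ((algebraMap (𝓞 K) (𝓞 (ringClassField K ι M)) k : ringClassField K ι M)) =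
        algebraMap (𝓞 K) (AlgebraicClosure K) k
      rw [show ((algebraMap (𝓞 K) (𝓞 (ringClassField K ι M)) k : ringClassField K ι M)) =
          algebraMap K (ringClassField K ι M) (k : K) from rfl, eM.commutes,
        IsScalarTower.algebraMap_apply (𝓞 K) K (AlgebraicClosure K)]
    obtain ⟨𝔐, h𝔐⟩ := v.localPrimesAbove_nonempty
    set 𝔓 := v.primeBelow (closureEmb (K := K) (v.adicCompletion K)) 𝔐 with h𝔓def
    have h𝔓 : 𝔓 ∈ v.primesAbove := primeBelow_mem_primesAbove h𝔐
    haveI := h𝔓.1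
    set P : Ideal (𝓞 (ringClassField K ι M)) := 𝔓.comap ιM with hPdef
    haveI hPprime : P.IsPrime := Ideal.comap_isPrime ιM 𝔓
    haveI hPover : P.LiesOver v.asIdeal := by
      constructor
      change v.asIdeal = Ideal.comap (algebraMap (𝓞 K) (𝓞 (ringClassField K ι M))) (Ideal.comap ιM 𝔓)
      rw [Ideal.comap_comap, hιcomp]
      exact h𝔓.2.over
    haveI : v.asIdeal.IsMaximal := v.isMaximal
    have hcardStab : Nat.card (MulAction.stabilizer (ringClassField K ι M ≃ₐ[K] ringClassField K ι M) P) = 2 := by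
      rw [Ideal.card_stabilizer_eq (G := (ringClassField K ι M ≃ₐ[K] ringClassField K ι M)) v.asIdeal P, hef]
    -- every `π (ρ τ)` stabilises `P` (the local Galois group restricts into the decomposition group)
    have hrι : ∀ (τ : absoluteGaloisGroup (v.adicCompletion K)) (b : 𝓞 (ringClassField K ι M)),
        ιM (π (ρ τ) • b) = (resGal (K := K) (v.adicCompletion K) τ) • ιM b := by
      intro τ b
      apply Subtype.ext
      rw [integralClosure.coe_smul, hιcoe, hιcoe]
      change eM (π (ρ τ) (b : ringClassField K ι M)) = _
      rw [heM, hπapp, hρ]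
      rfl
    have hstab : ∀ τ, π (ρ τ) ∈ MulAction.stabilizer (ringClassField K ι M ≃ₐ[K] ringClassField K ι M) P := by
      intro τ
      have hg := resGalOfEmb_mem_decompositionSubgroup_primeBelow v
        (closureEmb (K := K) (v.adicCompletion K)) h𝔐 τ
      have hgP : π (ρ τ) ∈ P.decompositionSubgroup (ringClassField K ι M ≃ₐ[K] ringClassField K ι M) := by
        rw [Ideal.mem_decompositionSubgroup_iff]
        ext b
        rw [Ideal.mem_pointwise_smul_iff_inv_smul_mem, hPdef, Ideal.mem_comap, Ideal.mem_comap,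
          ← map_inv, ← map_inv, hrι, map_inv (resGal (K := K) (v.adicCompletion K)) τ,
          ← Ideal.mem_pointwise_smul_iff_inv_smul_mem]
        change _ ∈ (resGalOfEmb (closureEmb (K := K) (v.adicCompletion K)) τ) • 𝔓 ↔ _
        rw [Ideal.mem_decompositionSubgroup_iff.mp hg]
      exact hgP
    -- counting: `#D = #ker(π|D) · #π(D)`, `#ker(π|D) ∣ [K[N]:K[M]]` odd, `#π(D) ∣ 2`
    set πD := π.comp D.subtype with hπDdef
    have hb : Nat.card πD.range ∣ 2 := by
      rw [← hcardStab]
      apply Subgroup.card_dvd_of_le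
      rintro _ ⟨⟨_, ⟨τ, rfl⟩⟩, rfl⟩
      exact hstab τ
    have ha : Nat.card πD.ker ∣ finrank (subfieldIn ι N M) (ringClassField K ι N) := by
      rw [← hker]
      have hk : πD.ker = π.ker.subgroupOf D := (MonoidHom.comap_ker π D.subtype).symm
      rw [hk, ← Subgroup.card_map_of_injective D.subtype_injective, Subgroup.subgroupOf_map_subtype]
      exact Subgroup.card_dvd_of_le inf_le_left
    have hab : Nat.card πD.ker * Nat.card πD.range = Nat.card D := by
      rw [← Subgroup.index_ker]
      exact Subgroup.card_mul_index _
    -- arithmetic: `a · b = 2 · index`, `a` odd, `b ∣ 2` ⇒ `index = a` odd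
    have hodd_a : Odd (Nat.card πD.ker) := hodd.of_dvd_nat ha
    rw [← hD2] at hab
    have hidx : Odd ((Subgroup.zpowers φ).comap ρ).index := by
      rcases (Nat.dvd_prime Nat.prime_two).mp hb with hb1 | hb2
      · exfalso
        rw [hb1, mul_one] at hab
        rw [hab] at hodd_a
        exact (Nat.not_even_iff_odd.mpr hodd_a) (even_two_mul _)
      · rw [hb2, mul_comm] at hab
        rw [Nat.eq_of_mul_eq_mul_left two_pos hab] at hodd_a
        exact hodd_a
    exact Nat.isCoprime_iff_coprime.mpr
      (Nat.Coprime.symm ((Nat.Prime.coprime_iff_not_dvd Nat.prime_two).mpr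
        (Nat.not_even_iff_odd.mpr hidx ∘ even_iff_two_dvd.mpr)))
  · -- DICHOTOMY on `Φ = ρ⁻¹ {1, φ}`
    intro τ hτ
    rw [Subgroup.mem_comap] at hτ
    obtain ⟨k, hk⟩ := Subgroup.mem_zpowers_iff.mp hτ
    have hφz : φ ^ (2 : ℤ) = 1 := by rw [zpow_two]; exact hφ2
    have hcases : ρ τ = 1 ∨ ρ τ = φ := by
      rw [← hk]
      obtain ⟨j, rfl | rfl⟩ := Int.even_or_odd' k
      · left
        rw [zpow_mul, hφz, one_zpow]
      · right
        rw [zpow_add, zpow_mul, hφz, one_zpow, one_mul, zpow_one]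
    rcases hcases with h1 | h2
    · left
      intro x
      rw [← hρ, h1, AlgEquiv.one_apply]
    · right
      intro x
      rw [← hρ, h2]


/-! ## §2 THEOREM (γ): the LOCAL clause of the tower fixing at `w ∣ 3` in the Sylvester tower `K[9pn]` -/

/-- **THEOREM (γ) — the LOCAL clause of `hTF` at `w ∣ 3` from decomposition membership.**  `K ⊨ ω² + ω + 1 = 0`,
`[K : ℚ] = 2`, `p` prime with `p % 3 = 1`, `n ≠ 0` with `3 ∤ n`, `e : K[9pn] → K̄` over `K`, `v ∋ 3`, and an involution
`φ ≠ 1` of `K[9pn]/K` through which some `τ₀ ∈ Γ_{K_v}` acts on `e(K[9pn])`: then `∃ Φ ≤ Γ_{K_v}` open, of index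
prime to `2`, acting on `e(K[9pn])` through `{1, φ}` — the `∃ Φ` clause of
`SylvesterTwoHeegnerIndexCMHalfLayerL1`'s `hTF` verbatim.  Inputs: `[K[9pn] : K[pn]] = 9` (odd) and
`e_v f_v (K[pn]/K) = 1 · 2`. [cite: NeukirchANT1999, Ch. II §9 Prop. (9.6) and Ch. I §9 (9.3)–(9.6)]
[cite: Cox2013, §7.D Cor. 7.28, §9.A (9.1) (PDF pp. 161, 192–193)] [cite: HuShuYin2019, §2.2 Prop. 2.4 (PDF pp. 6–7: the tower H_{9p} ⊇ H_{3p} ⊇ H_p)] -/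
theorem JZero.exists_oddIndex_subgroup_sylvesterTower (hω : ω ^ 2 + ω + 1 = 0) (h2 : finrank ℚ K = 2)
    (ι : K →+* ℂ) {p : ℕ} (hp : p.Prime) (hp3 : p % 3 = 1) {n : ℕ} (hn : n ≠ 0) (hn3 : ¬ 3 ∣ n)
    (e : ringClassField K ι (9 * p * n) →+* AlgebraicClosure K)
    (he : ∀ k : K, e (algebraMap K (ringClassField K ι (9 * p * n)) k) = algebraMap K (AlgebraicClosure K) k)
    (v : HeightOneSpectrum (𝓞 K)) (h3v : ((3 : ℕ) : 𝓞 K) ∈ v.asIdeal)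
    {φ : ringClassField K ι (9 * p * n) ≃ₐ[K] ringClassField K ι (9 * p * n)} (hφ1 : φ ≠ 1) (hφ2 : φ * φ = 1)
    (hφD : ∃ τ₀ : absoluteGaloisGroup (v.adicCompletion K), ∀ x : ringClassField K ι (9 * p * n),
      (show AlgebraicClosure K ≃ₐ[K] AlgebraicClosure K from
        resGal (K := K) (v.adicCompletion K) τ₀) (e x) = e (φ x)) :
    ∃ Φ : Subgroup (absoluteGaloisGroup (v.adicCompletion K)),
      IsOpen (Φ : Set (absoluteGaloisGroup (v.adicCompletion K))) ∧ IsCoprime (Φ.index : ℤ) ((2 : ℕ) : ℤ) ∧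
      ∀ τ ∈ Φ, (∀ x : ringClassField K ι (9 * p * n), (show AlgebraicClosure K ≃ₐ[K] AlgebraicClosure K from
          resGal (K := K) (v.adicCompletion K) τ) (e x) = e x) ∨
        (∀ x : ringClassField K ι (9 * p * n), (show AlgebraicClosure K ≃ₐ[K] AlgebraicClosure K from
          resGal (K := K) (v.adicCompletion K) τ) (e x) = e (φ x)) := by
  have hK := JZero.isImaginaryQuadratic_of_sq_add_self_add_one hω h2
  have hpn3 : ¬ 3 ∣ p * n := by
    intro h
    rcases (Nat.Prime.dvd_mul Nat.prime_three).mp h with h3 | h3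
    · have := Nat.eq_zero_of_dvd_of_lt h3
      omega
    · exact hn3 h3
  have hpn2 : 2 ≤ p * n := le_trans hp.two_le (Nat.le_mul_of_pos_right p (Nat.pos_of_ne_zero hn))
  have hMN : p * n ∣ 9 * p * n := ⟨9, by ring⟩
  have hN : 9 * p * n ≠ 0 := mul_ne_zero (mul_ne_zero (by norm_num) hp.ne_zero) hn
  have hodd : Odd (finrank (subfieldIn ι (9 * p * n) (p * n)) (ringClassField K ι (9 * p * n))) := by
    have key : ∀ N : ℕ, N = 9 * (p * n) →
        Odd (finrank (subfieldIn ι N (p * n)) (ringClassField K ι N)) := by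
      rintro N rfl
      rw [JZero.finrank_subfieldIn_nine_mul hω h2 ι hpn3 hpn2]
      exact ⟨4, rfl⟩
    exact key _ (by ring)
  have hef : v.asIdeal.ramificationIdxIn (𝓞 (ringClassField K ι (p * n))) *
      v.asIdeal.inertiaDegIn (𝓞 (ringClassField K ι (p * n))) = 2 := by
    rw [JZero.ramificationIdxIn_ringClassField_three hω h2 ι v h3v (mul_ne_zero hp.ne_zero hn) hpn3,
      JZero.inertiaDegIn_ringClassField_three hω h2 ι v h3v hpn3 hp hp3 (dvd_mul_right p n)]
  exact RingClassTower.exists_oddIndex_subgroup_of_exists_resGal_eq hK ι hMN hN hodd v hef e he hφ1 hφ2 hφD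

end Literature.NumberTheory.EllipticCurves.HuShuYin2019
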